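import Summits.HodgeConjecture.HodgeConjecture.Theorems.LinearSystemTorelliLocalTubeSpanFrameLiftBasic
import Mathlib.LinearAlgebra.Matrix.FixedDetMatrices
import Mathlib.LinearAlgebra.Matrix.GeneralLinearGroup.Defs

/-!
# Route LinearSystemTorelli — crux `LocalTubeSpan` (stmt-HodgeConjecture-2490): Janssen's Theorem 2.5 in rank 2

Helper file (`--supports stmt-HodgeConjecture-2490`, line `Sketch` of the crux chain, cycle 7
wave 2, lead c6; stub `rankTwoJanssen`).

Janssen's Theorem 2.5 in rank 2, unconditionally: every isometry of a rank-2 skew vanishing lattice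
preserving `ℤΔ` is monodromy (`SL₂(ℤ) = ⟨T_{δ₁}, T_{δ₂}⟩` for a unimodular pair) — the base case of
the line's one remaining named fact (`Janssen1983_thm2_5` of
`Literature/AlgebraicGeometry/HodgeTheory/SkewVanishingLattice`).

Proof (`localTubeSpan_janssen_thm2_5_of_finrank_eq_two`).  Pick `δ₁, δ₂ ∈ Δ` with `B(δ₁, δ₂) = 1`;
they are linearly independent (pair against `δ₂`, `δ₁`), hence a basis of `V` (`dim V = 2`), in
which every vector reads `v = B(v, δ₂) δ₁ - B(v, δ₁) δ₂`; for `v ∈ ℤΔ` the two coordinates are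
integers (integrality of `B` on `Δ`).  The basis turns `SL(2, ℤ)` into a subgroup of `GL(V)`
(`Matrix.SpecialLinearGroup.mapGL`, `Matrix.GeneralLinearGroup.toLin'`; columns = images of
`δ₁, δ₂`, `localTubeSpan_rankTwo_toLin'_apply`).  Under this map `T = !![1,1;0,1] ↦ T_{δ₁}` and
`S = !![0,-1;1,0] ↦ (T_{δ₁} T_{δ₂} T_{δ₁})⁻¹`, so (`SL(2, ℤ) = ⟨S, T⟩`, Mathlib's
`SpecialLinearGroup.SL2Z_generators`) all of `SL(2, ℤ)` lands in `Γ_Δ`; and an isometry `g`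
preserving `ℤΔ` is the image of its (integral, determinant-one) matrix.

No named facts; no `sorry`.
-/

-- `Summit.HodgeConjecture.HodgeConjecture.Theorems` is the mandated namespace (single-conjunct summit:
-- Sub = Summit), which `linter.dupNamespace` flags on every declaration; the lakefile turns the
-- linter off tree-wide (weak option), restated here so stand-alone elaboration is warning-free too.
set_option linter.dupNamespace false

noncomputable section

open Literature.AlgebraicGeometry.HodgeTheory
open scoped MatrixGroups

namespace Summit.HodgeConjecture.HodgeConjecture.Theorems

variable {V : Type} [AddCommGroup V] [Module ℚ V]

/-! ### `SL(2, ℤ)` inside `GL(V)` through a basis of a plane -/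

/-- Through a basis `b = (b₀, b₁)` of `V`, the element `M ∈ SL(2, ℤ)` acts on `V` as the invertible
endomorphism whose matrix is `M`: `b_j ↦ M₀ⱼ b₀ + M₁ⱼ b₁` (columns = images). [folklore] -/
theorem localTubeSpan_rankTwo_toLin'_apply (b : Module.Basis (Fin 2) ℚ V) (M : SL(2, ℤ)) :
    ((((Matrix.GeneralLinearGroup.toLin' b).toMonoidHom.comp
        (Matrix.SpecialLinearGroup.mapGL ℚ)) M : (V →ₗ[ℚ] V)ˣ) : V →ₗ[ℚ] V) (b 0) =
        ((M 0 0 : ℤ) : ℚ) • b 0 + ((M 1 0 : ℤ) : ℚ) • b 1 ∧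
      ((((Matrix.GeneralLinearGroup.toLin' b).toMonoidHom.comp
        (Matrix.SpecialLinearGroup.mapGL ℚ)) M : (V →ₗ[ℚ] V)ˣ) : V →ₗ[ℚ] V) (b 1) =
        ((M 0 1 : ℤ) : ℚ) • b 0 + ((M 1 1 : ℤ) : ℚ) • b 1 := by
  have key : ∀ j : Fin 2, ((((Matrix.GeneralLinearGroup.toLin' b).toMonoidHom.comp
      (Matrix.SpecialLinearGroup.mapGL ℚ)) M : (V →ₗ[ℚ] V)ˣ) : V →ₗ[ℚ] V) (b j) =
        ((M 0 j : ℤ) : ℚ) • b 0 + ((M 1 j : ℤ) : ℚ) • b 1 := by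
    intro j
    have key :=
      Matrix.GeneralLinearGroup.toLin'_apply b (Matrix.SpecialLinearGroup.mapGL ℚ M) (b j)
    rw [Module.Basis.repr_self, Finsupp.single_eq_pi_single, Matrix.mulVec_single_one,
      Fintype.linearCombination_apply, Fin.sum_univ_two,
      LinearMap.GeneralLinearGroup.coe_toLinearEquiv] at key
    rw [MonoidHom.comp_apply, MulEquiv.coe_toMonoidHom, key]
    simp [Matrix.col_apply, Matrix.SpecialLinearGroup.mapGL_coe_matrix]
  exact ⟨key 0, key 1⟩

/-- Two invertible endomorphisms of a plane agreeing on a basis `(b₀, b₁)` are equal. [folklore] -/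
theorem localTubeSpan_rankTwo_units_ext (b : Module.Basis (Fin 2) ℚ V) (u u' : (V →ₗ[ℚ] V)ˣ)
    (h0 : (u : V →ₗ[ℚ] V) (b 0) = (u' : V →ₗ[ℚ] V) (b 0))
    (h1 : (u : V →ₗ[ℚ] V) (b 1) = (u' : V →ₗ[ℚ] V) (b 1)) : u = u' :=
  Units.ext (b.ext fun i => by fin_cases i <;> assumption)

/-- A pair `δ₁, δ₂` with `B(δ₁, δ₂) = 1` for an alternating form is linearly independent: pairing a
relation `s δ₁ + t δ₂ = 0` against `δ₂` and `δ₁` gives `s = 0` and `-t = 0`. [folklore] -/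
theorem localTubeSpan_rankTwo_linearIndependent_pair (B : LinearMap.BilinForm ℚ V) (hB : B.IsAlt)
    {δ₁ δ₂ : V} (h12 : B δ₁ δ₂ = 1) : LinearIndependent ℚ ![δ₁, δ₂] := by
  refine LinearIndependent.pair_iff.2 fun s t hst => ?_
  have e1 := congrArg (fun v => B v δ₂) hst
  have e2 := congrArg (fun v => B v δ₁) hst
  have h21 : B δ₂ δ₁ = -1 := by rw [← hB.neg_eq, h12]
  simp only [map_add, map_smul, LinearMap.add_apply, LinearMap.smul_apply, smul_eq_mul, h12, h21,
    hB.self_eq_zero, map_zero, LinearMap.zero_apply, mul_one, mul_zero, add_zero, zero_add]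
    at e1 e2
  exact ⟨e1, by linarith⟩

/-- In the basis `δ₁, δ₂` (`B(δ₁, δ₂) = 1`, `B` alternating) the coordinates of
`v = r₀ δ₁ + r₁ δ₂` are `r₀ = B(v, δ₂)` and `r₁ = -B(v, δ₁)`. [folklore] -/
theorem localTubeSpan_rankTwo_coordinates (B : LinearMap.BilinForm ℚ V) (hB : B.IsAlt)
    {δ₁ δ₂ : V} (h12 : B δ₁ δ₂ = 1) (r₀ r₁ : ℚ) :
    B (r₀ • δ₁ + r₁ • δ₂) δ₂ = r₀ ∧ B (r₀ • δ₁ + r₁ • δ₂) δ₁ = -r₁ := by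
  have h21 : B δ₂ δ₁ = -1 := by rw [← hB.neg_eq, h12]
  constructor <;>
    simp only [map_add, map_smul, LinearMap.add_apply, LinearMap.smul_apply, smul_eq_mul, h12, h21,
      hB.self_eq_zero, mul_one, mul_zero, add_zero, zero_add, mul_neg]

/-- The pairing of two vectors of the plane in the coordinates of the basis `δ₁, δ₂`
(`B(δ₁, δ₂) = 1`, `B` alternating): `B(a δ₁ + c δ₂, b δ₁ + d δ₂) = a d - b c`. [folklore] -/
theorem localTubeSpan_rankTwo_pairing_eq_det (B : LinearMap.BilinForm ℚ V) (hB : B.IsAlt)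
    {δ₁ δ₂ : V} (h12 : B δ₁ δ₂ = 1) (a b c d : ℚ) :
    B (a • δ₁ + c • δ₂) (b • δ₁ + d • δ₂) = a * d - b * c := by
  have h21 : B δ₂ δ₁ = -1 := by rw [← hB.neg_eq, h12]
  simp only [map_add, map_smul, LinearMap.add_apply, LinearMap.smul_apply, smul_eq_mul, h12, h21,
    hB.self_eq_zero, mul_one, mul_zero, add_zero, zero_add, mul_neg]
  ring

/-! ### Janssen's Theorem 2.5 in rank 2 -/

/-- **Janssen's Theorem 2.5 in rank 2, unconditionally.**  For an alternating form `B` on a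
`ℚ`-plane `V` and a skew vanishing lattice `Δ ⊆ V`, every invertible isometry `g` of `B` mapping
`ℤΔ` into itself lies in the monodromy group `Γ_Δ`.  (With `δ₁, δ₂ ∈ Δ`, `B(δ₁, δ₂) = 1`:
`ℤΔ = ℤδ₁ ⊕ ℤδ₂`, the matrix of `g` lies in `SL(2, ℤ) = ⟨S, T⟩`, and `T ↦ T_{δ₁}`,
`S ↦ (T_{δ₁} T_{δ₂} T_{δ₁})⁻¹`.) [cite: Janssen1983, Thm. 2.5] -/
theorem localTubeSpan_janssen_thm2_5_of_finrank_eq_two [FiniteDimensional ℚ V]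
    (B : LinearMap.BilinForm ℚ V) (hB : B.IsAlt) (Δ : Set V) (hΔ : IsSkewVanishingLattice B Δ)
    (h2 : Module.finrank ℚ V = 2) (g : (V →ₗ[ℚ] V)ˣ)
    (hiso : ∀ x y : V, B ((g : V →ₗ[ℚ] V) x) ((g : V →ₗ[ℚ] V) y) = B x y)
    (hpres : ∀ x ∈ Submodule.span ℤ Δ, (g : V →ₗ[ℚ] V) x ∈ Submodule.span ℤ Δ) :
    g ∈ transvectionGroup B Δ := by
  -- a unimodular pair and the basis it forms
  obtain ⟨δ₁, h₁, δ₂, h₂, h12⟩ := hΔ.exists_pair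
  have h11 : B δ₁ δ₁ = 0 := hB.self_eq_zero δ₁
  have h22 : B δ₂ δ₂ = 0 := hB.self_eq_zero δ₂
  have h21 : B δ₂ δ₁ = -1 := by rw [← hB.neg_eq, h12]
  have hli : LinearIndependent ℚ ![δ₁, δ₂] :=
    localTubeSpan_rankTwo_linearIndependent_pair B hB h12
  have hcard : Fintype.card (Fin 2) = Module.finrank ℚ V := by rw [Fintype.card_fin, h2]
  set b : Module.Basis (Fin 2) ℚ V := basisOfLinearIndependentOfCardEqFinrank hli hcard
  have hb : ⇑b = ![δ₁, δ₂] := coe_basisOfLinearIndependentOfCardEqFinrank hli hcard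
  have hb0 : b 0 = δ₁ := by rw [hb]; rfl
  have hb1 : b 1 = δ₂ := by rw [hb]; rfl
  -- `SL(2, ℤ) → GL(V)` through the basis
  obtain ⟨φ, hφ⟩ : ∃ φ : SL(2, ℤ) →* (V →ₗ[ℚ] V)ˣ, ∀ M : SL(2, ℤ),
      ((φ M : (V →ₗ[ℚ] V)ˣ) : V →ₗ[ℚ] V) δ₁ = ((M 0 0 : ℤ) : ℚ) • δ₁ + ((M 1 0 : ℤ) : ℚ) • δ₂ ∧
      ((φ M : (V →ₗ[ℚ] V)ˣ) : V →ₗ[ℚ] V) δ₂ = ((M 0 1 : ℤ) : ℚ) • δ₁ + ((M 1 1 : ℤ) : ℚ) • δ₂ := by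
    refine ⟨(Matrix.GeneralLinearGroup.toLin' b).toMonoidHom.comp
      (Matrix.SpecialLinearGroup.mapGL ℚ), fun M => ?_⟩
    have := localTubeSpan_rankTwo_toLin'_apply b M
    rwa [hb0, hb1] at this
  have hext : ∀ u u' : (V →ₗ[ℚ] V)ˣ, (u : V →ₗ[ℚ] V) δ₁ = (u' : V →ₗ[ℚ] V) δ₁ →
      (u : V →ₗ[ℚ] V) δ₂ = (u' : V →ₗ[ℚ] V) δ₂ → u = u' := fun u u' e0 e1 =>
    localTubeSpan_rankTwo_units_ext b u u' (by rw [hb0]; exact e0) (by rw [hb1]; exact e1)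
  -- the two transvections `T_{δ₁}`, `T_{δ₂}` as elements of `Γ_Δ`
  set Γ : Subgroup (V →ₗ[ℚ] V)ˣ := transvectionGroup B Δ
  set T₁ : (V →ₗ[ℚ] V)ˣ :=
    LinearMap.GeneralLinearGroup.ofLinearEquiv (skewTransvectionEquiv B h11)
  set T₂ : (V →ₗ[ℚ] V)ˣ :=
    LinearMap.GeneralLinearGroup.ofLinearEquiv (skewTransvectionEquiv B h22)
  have hT₁Γ : T₁ ∈ Γ := unit_skewTransvection_mem_transvectionGroup B h₁ h11
  have hT₂Γ : T₂ ∈ Γ := unit_skewTransvection_mem_transvectionGroup B h₂ h22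
  have hT₁v : ∀ x, (T₁ : V →ₗ[ℚ] V) x = x - B x δ₁ • δ₁ := fun x => skewTransvection_apply B δ₁ x
  have hT₂v : ∀ x, (T₂ : V →ₗ[ℚ] V) x = x - B x δ₂ • δ₂ := fun x => skewTransvection_apply B δ₂ x
  -- `φ T = T_{δ₁}`
  have hφT : φ ModularGroup.T = T₁ := by
    refine hext _ _ ?_ ?_
    · rw [(hφ _).1, hT₁v, h11, zero_smul, sub_zero]
      simp [ModularGroup.coe_T]
    · rw [(hφ _).2, hT₁v, h21, neg_smul, one_smul, sub_neg_eq_add]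
      simp [ModularGroup.coe_T, add_comm]
  -- `T_{δ₁} T_{δ₂} T_{δ₁} (φ S) = 1`
  have hφS : T₁ * T₂ * T₁ * φ ModularGroup.S = 1 := by
    refine hext _ _ ?_ ?_
    · have e : ((φ ModularGroup.S : (V →ₗ[ℚ] V)ˣ) : V →ₗ[ℚ] V) δ₁ = δ₂ := by
        rw [(hφ _).1]; simp [ModularGroup.coe_S]
      simp only [Units.val_mul, Module.End.mul_apply, Units.val_one, Module.End.one_apply, e,
        hT₁v, hT₂v, map_sub, map_smul, LinearMap.sub_apply, LinearMap.smul_apply, smul_eq_mul,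
        h11, h12, h21, h22]
      module
    · have e : ((φ ModularGroup.S : (V →ₗ[ℚ] V)ˣ) : V →ₗ[ℚ] V) δ₂ = -δ₁ := by
        rw [(hφ _).2]; simp [ModularGroup.coe_S]
      simp only [Units.val_mul, Module.End.mul_apply, Units.val_one, Module.End.one_apply, e,
        hT₁v, hT₂v, map_sub, map_smul, map_neg, LinearMap.sub_apply, LinearMap.smul_apply,
        smul_eq_mul, h11, h12, h21]
      module
  have hSΓ : φ ModularGroup.S ∈ Γ := by
    rw [eq_inv_of_mul_eq_one_right hφS]
    exact Γ.inv_mem (Γ.mul_mem (Γ.mul_mem hT₁Γ hT₂Γ) hT₁Γ)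
  have hTΓ : φ ModularGroup.T ∈ Γ := hφT ▸ hT₁Γ
  -- hence `φ(SL(2, ℤ)) ⊆ Γ_Δ`
  have hle : Subgroup.closure {ModularGroup.S, ModularGroup.T} ≤ Γ.comap φ := by
    rw [Subgroup.closure_le]
    rintro x (rfl | rfl)
    · exact Subgroup.mem_comap.2 hSΓ
    · exact Subgroup.mem_comap.2 hTΓ
  have hall : ∀ M : SL(2, ℤ), φ M ∈ Γ := fun M =>
    Subgroup.mem_comap.1
      (hle (by rw [SpecialLinearGroup.SL2Z_generators]; exact Subgroup.mem_top M))
  -- coordinates in the basis `δ₁, δ₂`; integral on `ℤΔ`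
  have hcoord : ∀ v : V, v = B v δ₂ • δ₁ + (-B v δ₁) • δ₂ := by
    intro v
    obtain ⟨r₀, r₁, rfl⟩ : ∃ r₀ r₁ : ℚ, v = r₀ • δ₁ + r₁ • δ₂ := by
      refine ⟨b.repr v 0, b.repr v 1, ?_⟩
      have := b.sum_repr v
      rwa [Fin.sum_univ_two, hb0, hb1, eq_comm] at this
    rw [(localTubeSpan_rankTwo_coordinates B hB h12 r₀ r₁).1,
      (localTubeSpan_rankTwo_coordinates B hB h12 r₀ r₁).2, neg_neg]
  have hint : ∀ δ ∈ Δ, ∀ y ∈ Submodule.span ℤ Δ, ∃ n : ℤ, B y δ = n := fun δ hδ y hy =>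
    localTubeSpan_exists_int_eq_of_mem_span_int B Δ δ (fun y hy => hΔ.integral y hy δ hδ) hy
  -- the integral matrix of `g`
  obtain ⟨a, ha⟩ := hint δ₂ h₂ _ (hpres δ₁ (Submodule.subset_span h₁))
  obtain ⟨c, hc⟩ := hint δ₁ h₁ _ (hpres δ₁ (Submodule.subset_span h₁))
  obtain ⟨b', hb'⟩ := hint δ₂ h₂ _ (hpres δ₂ (Submodule.subset_span h₂))
  obtain ⟨d, hd⟩ := hint δ₁ h₁ _ (hpres δ₂ (Submodule.subset_span h₂))
  have hg1 : (g : V →ₗ[ℚ] V) δ₁ = (a : ℚ) • δ₁ + ((-c : ℤ) : ℚ) • δ₂ := by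
    rw [Int.cast_neg, ← ha, ← hc]; exact hcoord _
  have hg2 : (g : V →ₗ[ℚ] V) δ₂ = (b' : ℚ) • δ₁ + ((-d : ℤ) : ℚ) • δ₂ := by
    rw [Int.cast_neg, ← hb', ← hd]; exact hcoord _
  have hdet : a * -d - b' * -c = 1 := by
    have h := hiso δ₁ δ₂
    rw [h12, hg1, hg2, localTubeSpan_rankTwo_pairing_eq_det B hB h12] at h
    exact_mod_cast h
  have hgφ : g = φ ⟨!![a, b'; -c, -d], by rwa [Matrix.det_fin_two_of]⟩ :=
    hext _ _ (by rw [(hφ _).1, hg1]; rfl) (by rw [(hφ _).2, hg2]; rfl)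
  rw [hgφ]
  exact hall _

end Summit.HodgeConjecture.HodgeConjecture.Theorems

end
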